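import Summits.Ventures.QEC.CircuitDistance.ETowerDataX
import Summits.Ventures.QEC.CircuitDistance.ETowerBinder
import Summits.Ventures.QEC.CircuitDistance.PortK2InstBB144Defs
import HarnessLib

/-!
# P3-PORT STEP 2 (E-fold tower), sector X: the S7 BRIDGE DATA — anchored top classes `TOPS` versus the listed words of record,
# and index translation versus support translation (ASSEMBLY-SPEC §B11; cell `qec`, experiment CDX, seat qec-cdx-type-1)

`topsOK`: entry `i` of eng-1's `TOPS` (ETowerDataX), read as a set of class supports through `instX144.G`, is a translate of a
listed word (witness index + translation `topsWit`, checked in kernel) (`wordsX144 = bb144XLeaves.map (·.word)`) — decided; `idxOK`: the two generator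
identities `G (transIdx 12 6 g n) = trQ g (G n)` (`idxTrCheck`).  Unpacked: `hTOPS`, `hidx` = the data hypotheses of
`ETowerBinder.binder_of_kc`.  No `native_decide`; nothing here asserts a value of `d_circ`.
-/

set_option maxRecDepth 100000
set_option exponentiation.threshold 1024

namespace Summit.Ventures.QEC.CircuitDistance.ETower.SecX

open Literature.InformationTheory.QuantumCodes Summit.Ventures.QEC.Census Summit.Ventures.QEC.Census.Fold
  Summit.Ventures.QEC.CircuitDistance.ETower K2

/-- DATA: for each entry of `TOPS`, the listed word it comes from and the translation (found offline; CHECKED below). -/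
def topsWit : List (ℕ × ℕ × ℕ) := [(0, 0, 0), (1, 0, 0), (4, 0, 0), (2, 0, 0), (3, 0, 0)]

/-- Bool: `TOPS[i]` is the stated translate of the stated listed word, for every `i`. -/
def topsCheck : Bool :=
  (List.range TOPS.length).all fun i =>
    decide ((topsWit.getD i (0, 0, 0)).1 < wordsX144.length) &&
    decide (((bitsOf 360 0 (TOPS.getD i 0)).map instX144.G).toFinset =
      ((wordsX144.getD (topsWit.getD i (0, 0, 0)).1 []).map
        (trQ (Fin.ofNat 12 (topsWit.getD i (0, 0, 0)).2.1, Fin.ofNat 6 (topsWit.getD i (0, 0, 0)).2.2))).toFinset)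

/-- KERNEL: the anchored top classes are translates of listed words. -/
theorem topsOK : topsCheck = true := by decide +kernel

/-- **`hTOPS`** of `binder_of_kc` for sector X. -/
theorem hTOPS : ∀ r ∈ TOPS, ∃ wd ∈ wordsX144, ∃ t : BB.Mono 12 6,
    ((bitsOf (5 * (12 * 6)) 0 r).map instX144.G).toFinset = (wd.map (trQ t)).toFinset := by
  have h := topsOK
  unfold topsCheck at h
  rw [List.all_eq_true] at h
  intro r hr
  obtain ⟨i, hi, rfl⟩ := List.getElem_of_mem hr
  have := h i (List.mem_range.2 hi)
  rw [Bool.and_eq_true, decide_eq_true_eq, decide_eq_true_eq, List.getD_eq_getElem _ _ hi] at this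
  obtain ⟨hw, ht⟩ := this
  refine ⟨_, ?_, _, ht⟩
  rw [List.getD_eq_getElem _ _ hw]; exact List.getElem_mem hw

/-- KERNEL: index translation by the two torus generators = support translation. -/
theorem idxOK : idxTrCheck 5 instX144.G = true := by decide +kernel

/-- **`hidx`** of `binder_of_kc` for sector X (all translations). -/
theorem hidx : ∀ da db n, n < 5 * (12 * 6) →
    instX144.G (transIdx 12 6 da db n) = trQ (Fin.ofNat 12 da, Fin.ofNat 6 db) (instX144.G n) :=
  idxTr_all_of_gens (by decide) (by decide) instX144.G (idxTr_of_check idxOK).1 (idxTr_of_check idxOK).2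

end Summit.Ventures.QEC.CircuitDistance.ETower.SecX
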